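import Summits.ResolutionOfSingularities.ResolutionOfSingularities.Theorems.HilbertSamuelEliminationSigmaMaxModificationsCorridor3WLadderMovingRows
import HarnessLib

/-!
# [OURS · L1 W4.2] Row β of `stub_Wlow3M_two` (crux chain w42, line `w_ladder` v5) — regime bookkeeping and the
# units/strata cut for the complement of (F1)

Stub worker res-L1-w42-stub-3 (gen 3), CHAIN v3.7 SEAT TABLE «stub-3 successor → `stub_Wlow3M_two` β». Registered stub
(skeleton `w_ladder` v5, sha16 `e55bf4f23146f08b`, on stmt-ResolutionOfSingularities-19249):
`WLadder.stub_Wlow3M_two : ∀ p, p.Prime → Moving.Wlow3TwoM p` — outside the (F1) regime `QCharRegime p` («`3 ≤ p` or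
`dim X ≤ 2`») no infinite MOVING chain of constant grade `ē = e ≤ 2` from a maximal origin at level `3`.

Everything here is PROVED and is BOOKKEEPING (no geometry); it fixes the exact shape of what the row's provers owe:

* §1 REGIME. For a prime `p ≠ 2` the row `Wlow3TwoM p` (and its helper rows β `Wlow3TwoPerfectM p`, γ `Wlow3TwoImperfectM p`)
  is VACUOUS (`Helpers.eq_two_of_not_qCharRegime`): `wlow3TwoM_of_ne_two`, `wlow3TwoPerfectM_of_ne_two`,
  `wlow3TwoImperfectM_of_ne_two`. Hence the registered stub follows from the single prime `2`
  (`stub_Wlow3M_two_of_two`), i.e. from β at `2` and γ at `2` (`stub_Wlow3M_two_of_regimes_two`), and a non-`QCharRegime`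
  maximal origin at level `3` lives on a scheme of dimension exactly `3` (`not_dim_le_two_of_not_qCharRegime`,
  `dim_eq_three_of_isMaximalOrigin_of_not_qCharRegime`).
* §2 THE UNITS/STRATA CUT, `Q`-GENERIC (the §MD.2 cut of `…Corridor3WLadderMovingRows`, which is stated there only for
  `Q = QCharRegime p`): for ANY origin predicate `Q`, «no moving `ē ≤ 2` chain is isolated in the HS-locus infinitely often»
  (units-half) and «no moving `ē ≤ 2` chain is non-isolated at every stage» (strata-half) give every exact grade `e ≤ 2`
  (`maxOriginNoMovingNearChainAtQ_exactLow_of_units_strata`); instantiated to β (`wlow3TwoPerfectM_of_units_strata`) and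
  γ (`wlow3TwoImperfectM_of_units_strata`); the converse directions are free (`maxOriginNoMovingRecurrentNearChainAtQ_of_row`,
  `maxOriginNoMovingNearChainAtQ_strata_of_row`), the `Q`-restricted moving-tail join of the exact grades under W-mono is
  `maxOriginNoMovingNearChainAtQ_low_of_exactGrades`, and the all-origin strata row `WlowStrataM p` (idea-2, §3a) serves
  every regime at once (`strata_halves_of_wlowStrataM`, `wlow3CharStrataM_of_wlowStrataM`).

OURS (cell res-hironaka, slot W4.2); NOT statements of the manuscript [Hironaka2017] nor of [CossartJannsenSaito2020];
AI-drafted, weaker than expert review. References: CJS LNM 2270 p. 103 (F1), Thm. 3.14, Thm. 6.35, Thm. 6.40, Def. 13.3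
[CossartJannsenSaito2020]; tree `…Corridor3WLadderMovingDefs` / `…MovingRows` (plan-1 helpers v3.6, p496136 ff.).
-/

noncomputable section

-- plan-1/idea-2 module setting kept verbatim (namespace `…Corridor3.Moving` re-enters `…Corridor3`)
set_option linter.dupNamespace false

open CategoryTheory AlgebraicGeometry TopologicalSpace
open Summit.ResolutionOfSingularities.ResolutionOfSingularities.Theorems.CampaignW42
open Literature.AlgebraicGeometry.Resolution Literature.RingTheory.HilbertSamuel
open Literature.AlgebraicGeometry.CossartJannsenSaito2020
open Summit.ResolutionOfSingularities.ResolutionOfSingularities.Theses.HilbertSamuelElimination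
open Summit.ResolutionOfSingularities.ResolutionOfSingularities.Theorems.SigmaMaxModificationsCorridor3

namespace Summit.ResolutionOfSingularities.ResolutionOfSingularities.Theorems.SigmaMaxModificationsCorridor3.Moving

universe u

section Beta

open Summit.ResolutionOfSingularities.ResolutionOfSingularities.Theorems.SigmaMaxModificationsCorridor3.Helpers
  (ClosedOriginGeomDirDimNonincrease QPerfectResidueField QCharRegime eq_two_of_not_qCharRegime)

/-! ## §1. Regime bookkeeping: the row is about the prime `2` and threefolds only -/

/-- Outside the prime `2` every `Q`-row cut by `¬ QCharRegime p` is vacuous: a prime `p ≠ 2` has `3 ≤ p`. [folklore] -/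
theorem maxOriginNoMovingNearChainAtQ_of_ne_two {p : ℕ} (hp : p.Prime) (hp2 : p ≠ 2)
    (Q : ℕ → (ℕ → ℕ) → ∀ X : Scheme.{u}, X → Prop) (G : MarkedStage.{u} → Prop) :
    MaxOriginNoMovingNearChainAtQ.{u} p 3 (fun N ν X x => ¬ QCharRegime p N ν X x ∧ Q N ν X x) G :=
  fun _ _ _ _ _ _ _ _ hq => absurd (eq_two_of_not_qCharRegime hp hq.1).1 hp2

/-- `Wlow3TwoM p` is vacuous for a prime `p ≠ 2`. [folklore] -/
theorem wlow3TwoM_of_ne_two {p : ℕ} (hp : p.Prime) (hp2 : p ≠ 2) : Wlow3TwoM.{u} p :=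
  fun _ _ _ _ _ _ _ _ _ _ hq => absurd (eq_two_of_not_qCharRegime hp hq).1 hp2

/-- β `Wlow3TwoPerfectM p` is vacuous for a prime `p ≠ 2`. [folklore] -/
theorem wlow3TwoPerfectM_of_ne_two {p : ℕ} (hp : p.Prime) (hp2 : p ≠ 2) : Wlow3TwoPerfectM.{u} p :=
  fun e _ => maxOriginNoMovingNearChainAtQ_of_ne_two hp hp2 QPerfectResidueField fun s => s.geomDirDim = e

/-- γ `Wlow3TwoImperfectM p` is vacuous for a prime `p ≠ 2`. [folklore] -/
theorem wlow3TwoImperfectM_of_ne_two {p : ℕ} (hp : p.Prime) (hp2 : p ≠ 2) : Wlow3TwoImperfectM.{u} p :=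
  fun e _ => maxOriginNoMovingNearChainAtQ_of_ne_two hp hp2
    (fun N ν X x => ¬ QPerfectResidueField N ν X x) fun s => s.geomDirDim = e

/-- **The registered stub `stub_Wlow3M_two` follows from the single prime `2`.** [folklore] -/
theorem stub_Wlow3M_two_of_two (h : Wlow3TwoM.{u} 2) : ∀ p : ℕ, p.Prime → Wlow3TwoM.{u} p := by
  intro p hp
  by_cases hp2 : p = 2
  · subst hp2
    exact h
  · exact wlow3TwoM_of_ne_two hp hp2

/-- **The registered stub `stub_Wlow3M_two` follows from β and γ at the prime `2`.** [folklore] -/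
theorem stub_Wlow3M_two_of_regimes_two (hβ : Wlow3TwoPerfectM.{u} 2) (hγ : Wlow3TwoImperfectM.{u} 2) :
    ∀ p : ℕ, p.Prime → Wlow3TwoM.{u} p :=
  stub_Wlow3M_two_of_two (wlow3TwoM_of_regimes hβ hγ)

/-- A non-`QCharRegime` origin at characteristic `2` lies on a scheme of dimension `> 2`. [folklore] -/
theorem not_dim_le_two_of_not_qCharRegime {p N : ℕ} {ν : ℕ → ℕ} {X : Scheme.{u}} {x : X}
    (hq : ¬ QCharRegime p N ν X x) : ¬ topologicalKrullDim X ≤ ((2 : ℕ) : WithBot ℕ∞) :=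
  fun hd => hq (Or.inr hd)

/-- **The β/γ rows live exactly on threefolds**: a maximal origin at level `3` outside `QCharRegime p` lies on a scheme of
dimension exactly `3`. [folklore] -/
theorem dim_eq_three_of_isMaximalOrigin_of_not_qCharRegime {p : ℕ} {ν : ℕ → ℕ} {X : Scheme.{u}} {x : X}
    (hx : IsMaximalOrigin p 3 ν X x) (hq : ¬ QCharRegime p 3 ν X x) :
    topologicalKrullDim X = ((3 : ℕ) : WithBot ℕ∞) := by
  have h3 : topologicalKrullDim X ≤ ((3 : ℕ) : WithBot ℕ∞) := hx.dim_le
  have h2 := not_dim_le_two_of_not_qCharRegime hq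
  generalize topologicalKrullDim X = d at h3 h2 ⊢
  induction d using WithBot.recBotCoe with
  | bot => exact absurd bot_le h2
  | coe n =>
    induction n using ENat.recTopCoe with
    | top =>
      exfalso
      have : ((⊤ : ℕ∞) : WithBot ℕ∞) ≤ (((3 : ℕ) : ℕ∞) : WithBot ℕ∞) := h3
      rw [WithBot.coe_le_coe, top_le_iff] at this
      exact ENat.coe_ne_top 3 this
    | coe m =>
      have h3' : ((m : ℕ∞) : WithBot ℕ∞) ≤ (((3 : ℕ) : ℕ∞) : WithBot ℕ∞) := h3
      have h2' : ¬ ((m : ℕ∞) : WithBot ℕ∞) ≤ (((2 : ℕ) : ℕ∞) : WithBot ℕ∞) := h2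
      rw [WithBot.coe_le_coe, ENat.coe_le_coe] at h3' h2'
      have hm : m = 3 := by omega
      subst hm
      rfl

/-! ## §2. The units/strata cut for an arbitrary origin predicate `Q` (β / γ sockets) -/

/-- **UNITS/STRATA CUT, `Q`-generic (PROVED).** For any origin predicate `Q`: the units-half «no moving `ē ≤ 2` chain from a
`Q`-origin is isolated in the HS-locus infinitely often» and the strata-half «no moving `ē ≤ 2` chain from a `Q`-origin is
non-isolated at every stage» give every exact low grade `ē = e`, `e ≤ 2` (recurrence split at `B = Iso 3`, then sub-grade).
The case `Q = QCharRegime p` is `wlow3CharM_of_units_strata`. [folklore] -/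
theorem maxOriginNoMovingNearChainAtQ_exactLow_of_units_strata {p : ℕ}
    {Q : ℕ → (ℕ → ℕ) → ∀ X : Scheme.{u}, X → Prop}
    (hU : MaxOriginNoMovingRecurrentNearChainAtQ.{u} p 3 Q (fun s => s.geomDirDim ≤ 2) fun s => Iso 3 s)
    (hS : MaxOriginNoMovingNearChainAtQ.{u} p 3 Q fun s => s.geomDirDim ≤ 2 ∧ ¬ Iso 3 s) :
    ∀ e ≤ 2, MaxOriginNoMovingNearChainAtQ.{u} p 3 Q fun s => s.geomDirDim = e :=
  fun _ he => (maxOriginNoMovingNearChainAtQ_of_recurrence hS hU).mono fun s hs => by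
    show s.geomDirDim ≤ 2
    omega

/-- Converse bookkeeping: the `ē ≤ 2` row gives back the units-half (a recurrent moving chain is a moving chain). [folklore] -/
theorem maxOriginNoMovingRecurrentNearChainAtQ_of_row {p N : ℕ} {Q : ℕ → (ℕ → ℕ) → ∀ X : Scheme.{u}, X → Prop}
    {G : MarkedStage.{u} → Prop} (B : MarkedStage.{u} → Prop) (h : MaxOriginNoMovingNearChainAtQ.{u} p N Q G) :
    MaxOriginNoMovingRecurrentNearChainAtQ.{u} p N Q G B := by
  intro R hF hA ν X _ x hx hq
  rintro ⟨c, h0, hstep, hG, hmov, _⟩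
  exact h R hF hA ν X x hx hq ⟨c, h0, hstep, hG, hmov⟩

/-- Converse bookkeeping: the `ē ≤ 2` row gives back the strata-half (sub-grade). [folklore] -/
theorem maxOriginNoMovingNearChainAtQ_strata_of_row {p N : ℕ} {Q : ℕ → (ℕ → ℕ) → ∀ X : Scheme.{u}, X → Prop}
    {G : MarkedStage.{u} → Prop} (B : MarkedStage.{u} → Prop) (h : MaxOriginNoMovingNearChainAtQ.{u} p N Q G) :
    MaxOriginNoMovingNearChainAtQ.{u} p N Q fun s => G s ∧ ¬ B s :=
  h.mono fun _ hs => hs.1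

/-- With W-mono the exact low grades give the whole `ē ≤ 2` row from `Q`-origins (moving tail argument of
`maxOriginNoMovingNearChainAt_low_of_exactGrades`, `Q`-restricted). [folklore] -/
theorem maxOriginNoMovingNearChainAtQ_low_of_exactGrades {p N : ℕ} {Q : ℕ → (ℕ → ℕ) → ∀ X : Scheme.{u}, X → Prop}
    (hmono : ClosedOriginGeomDirDimNonincrease.{u} p N)
    (hlow : ∀ e ≤ 2, MaxOriginNoMovingNearChainAtQ.{u} p N Q fun s => s.geomDirDim = e) :
    MaxOriginNoMovingNearChainAtQ.{u} p N Q fun s => s.geomDirDim ≤ 2 := by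
  intro R hRf hRa ν X _ x hX hq
  rintro ⟨c, h0, hstep, hle, hmov⟩
  have hsc : ∀ n, Helpers.InScopeC p R N ν (c n) := fun n =>
    ⟨X, inferInstance, x, hX, reaches_chain h0 hstep n⟩
  have hg : ∀ n, (c (n + 1)).geomDirDim ≤ (c n).geomDirDim := fun n =>
    hmono R hRf hRa ν (c n) (c (n + 1)) (hsc n) (hstep n)
  obtain ⟨n₀, hn₀⟩ := eventually_const_of_succ_le (g := fun n => (c n).geomDirDim) hg
  exact hlow (c n₀).geomDirDim (hle n₀) R hRf hRa ν X x hX hq ⟨fun n => c (n₀ + n), reaches_chain h0 hstep n₀,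
    fun n => hstep (n₀ + n), fun n => by
      show (c (n₀ + n)).geomDirDim = (c n₀).geomDirDim
      exact hn₀ n, io_shift hmov n₀⟩

/-- **β socket (PROVED): units-half ∧ strata-half at β-origins ⇒ `Wlow3TwoPerfectM p`.** The origin predicate is
«`¬ QCharRegime p` ∧ perfect residue field». [folklore] -/
theorem wlow3TwoPerfectM_of_units_strata {p : ℕ}
    (hU : MaxOriginNoMovingRecurrentNearChainAtQ.{u} p 3
      (fun N ν X x => ¬ QCharRegime p N ν X x ∧ QPerfectResidueField N ν X x) (fun s => s.geomDirDim ≤ 2)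
      fun s => Iso 3 s)
    (hS : MaxOriginNoMovingNearChainAtQ.{u} p 3
      (fun N ν X x => ¬ QCharRegime p N ν X x ∧ QPerfectResidueField N ν X x)
      fun s => s.geomDirDim ≤ 2 ∧ ¬ Iso 3 s) :
    Wlow3TwoPerfectM.{u} p :=
  maxOriginNoMovingNearChainAtQ_exactLow_of_units_strata hU hS

/-- **γ socket (PROVED): units-half ∧ strata-half at γ-origins ⇒ `Wlow3TwoImperfectM p`** (γ itself is OPEN; barrier
`DirectrixSmallCharacteristic`). [folklore] -/
theorem wlow3TwoImperfectM_of_units_strata {p : ℕ}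
    (hU : MaxOriginNoMovingRecurrentNearChainAtQ.{u} p 3
      (fun N ν X x => ¬ QCharRegime p N ν X x ∧ ¬ QPerfectResidueField N ν X x) (fun s => s.geomDirDim ≤ 2)
      fun s => Iso 3 s)
    (hS : MaxOriginNoMovingNearChainAtQ.{u} p 3
      (fun N ν X x => ¬ QCharRegime p N ν X x ∧ ¬ QPerfectResidueField N ν X x)
      fun s => s.geomDirDim ≤ 2 ∧ ¬ Iso 3 s) :
    Wlow3TwoImperfectM.{u} p :=
  maxOriginNoMovingNearChainAtQ_exactLow_of_units_strata hU hS

/-- **The strata-halves of the two regimes are ONE statement split by the origin**: the all-origin strata row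
(`WlowStrataM`-shape, `Q`-free) gives the (F1)-regime strata-half `Wlow3CharStrataM p` and the β / γ strata-halves at once —
the interruptions lemma G1′ is regime-independent bookkeeping-wise (its CONTENT lives at generic points of curves, where (F1)
holds at every `p`). [folklore] -/
theorem strata_halves_of_wlowStrataM {p : ℕ} (h : WlowStrataM p)
    (Q : ℕ → (ℕ → ℕ) → ∀ X : Scheme.{0}, X → Prop) :
    MaxOriginNoMovingNearChainAtQ.{0} p 3 Q fun s => s.geomDirDim ≤ 2 ∧ ¬ Iso 3 s :=
  MaxOriginNoMovingNearChainAt.toQ h Q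

/-- In particular `WlowStrataM p` is exactly the conjunction-free source of `Wlow3CharStrataM p`. [folklore] -/
theorem wlow3CharStrataM_of_wlowStrataM {p : ℕ} (h : WlowStrataM p) : Wlow3CharStrataM p :=
  strata_halves_of_wlowStrataM h (QCharRegime p)

end Beta

end Summit.ResolutionOfSingularities.ResolutionOfSingularities.Theorems.SigmaMaxModificationsCorridor3.Moving

end
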